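import Mathlib
import Summits.CriticalPhenomena.PercolationContinuityZ3.Theorems.PinholeClosing.Negative.PinholeClosingBaseline
import Literature.Probability.Percolation.PercolationEvents
import HarnessLib

/-!
# Stub `stub_tightPocketLocal` of line `pocket-resampling-liveness-mass` (crux `PercBudgetLadder.PinholeClosing`, stmt-CriticalPhenomena-5249)

Locality and measurability of the tight-pocket event: the predicate 'A is a tight (k+1)-pocket of omega for the window (n,m)' reads only omega on edgesTouching A, hence is a cylinder event and measurable.

Registered signature (lead prover-line-stmt-CriticalPhenomena-5249-1, skeleton
`Cruxes/PinholeClosing/Lines/pocket_resampling_liveness_mass.lean` rev 1): proved VERBATIM below as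
`Summit.CriticalPhenomena.PercolationContinuityZ3.Theorems.stub_tightPocketLocal`; helper lemmas live in `namespace StubTightPocketLocal`.
No new definitions (tree vocabulary only).
-/

noncomputable section

namespace Summit.CriticalPhenomena.PercolationContinuityZ3.Theorems

open MeasureTheory Finset
open Literature.Probability.Percolation Literature.Probability.LatticeModels
open Summit.CriticalPhenomena.PercolationContinuityZ3.Theorems.PinholeClosing.Negative
open scoped Classical

namespace StubTightPocketLocal

/-- The edge boundary of a subset `A' ⊆ A` consists of lattice edges touching `A`:
a boundary edge of `A'` has an endpoint in `A' ⊆ A`. -/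
theorem edgeBoundary_subset_edgesTouching {A' A : Finset (Site 3)} (h : A' ⊆ A) :
    edgeBoundary (zdGraph 3) A' ⊆ edgesTouching (zdGraph 3) A := by
  intro e he
  rw [mem_edgeBoundary_iff] at he
  rw [mem_edgesTouching_iff]
  obtain ⟨hE, ⟨x, hx, hxe⟩, _⟩ := he
  exact ⟨hE, x, h hx, hxe⟩

/-- Two configurations agreeing on `T ⊇ S` have the same open edges inside `S`. -/
theorem filter_mem_eq_of_inter_eq {S T : Finset (Sym2 (Site 3))} {ω ω' : BondConfig (Site 3)}
    (hST : S ⊆ T) (h : ω ∩ (↑T : Set (Sym2 (Site 3))) = ω' ∩ ↑T) :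
    S.filter (· ∈ ω) = S.filter (· ∈ ω') := by
  refine Finset.filter_congr fun e he => ?_
  have heT : e ∈ (↑T : Set (Sym2 (Site 3))) := Finset.mem_coe.2 (hST he)
  exact ⟨fun hω => ((Set.ext_iff.1 h e).1 ⟨hω, heT⟩).1,
    fun hω' => ((Set.ext_iff.1 h e).2 ⟨hω', heT⟩).1⟩

/-- The number of open boundary edges of any `A' ⊆ A` is read off from `ω ∩ edgesTouching A`. -/
theorem card_filter_edgeBoundary_eq {A' A : Finset (Site 3)} (hA : A' ⊆ A)
    {ω ω' : BondConfig (Site 3)}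
    (h : ω ∩ (↑(edgesTouching (zdGraph 3) A) : Set (Sym2 (Site 3))) =
      ω' ∩ ↑(edgesTouching (zdGraph 3) A)) :
    ((edgeBoundary (zdGraph 3) A').filter (· ∈ ω)).card =
      ((edgeBoundary (zdGraph 3) A').filter (· ∈ ω')).card := by
  rw [filter_mem_eq_of_inter_eq (edgeBoundary_subset_edgesTouching hA) h]

/-- **Locality** of the tight-pocket predicate: it depends on `ω` only through
`ω ∩ edgesTouching A`. -/
theorem tightPocket_local (k n m : ℕ) (A : Finset (Site 3)) (ω ω' : BondConfig (Site 3))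
    (h : ω ∩ (↑(edgesTouching (zdGraph 3) A) : Set (Sym2 (Site 3))) =
      ω' ∩ ↑(edgesTouching (zdGraph 3) A)) :
    (((box 3 n ⊆ A ∧ A ⊆ box 3 m \ innerBoundary (zdGraph 3) (box 3 m)) ∧
          ((edgeBoundary (zdGraph 3) A).filter (· ∈ ω)).card ≤ k + 1 ∧
          ∀ A' : Finset (Site 3), (box 3 n ⊆ A' ∧ A' ⊆ box 3 m \ innerBoundary (zdGraph 3) (box 3 m)) →
            A' ⊂ A → k + 2 ≤ ((edgeBoundary (zdGraph 3) A').filter (· ∈ ω)).card) ↔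
        ((box 3 n ⊆ A ∧ A ⊆ box 3 m \ innerBoundary (zdGraph 3) (box 3 m)) ∧
          ((edgeBoundary (zdGraph 3) A).filter (· ∈ ω')).card ≤ k + 1 ∧
          ∀ A' : Finset (Site 3), (box 3 n ⊆ A' ∧ A' ⊆ box 3 m \ innerBoundary (zdGraph 3) (box 3 m)) →
            A' ⊂ A → k + 2 ≤ ((edgeBoundary (zdGraph 3) A').filter (· ∈ ω')).card)) := by
  rw [card_filter_edgeBoundary_eq (subset_refl A) h]
  refine and_congr_right fun _ => and_congr_right fun _ => ?_
  refine forall_congr' fun A' => forall_congr' fun _ => forall_congr' fun hA' => ?_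
  rw [card_filter_edgeBoundary_eq hA'.1 h]

/-- **Measurability** of the tight-pocket event: by locality it is a cylinder event on the
finite window `edgesTouching A`, hence measurable (`DeterminedBy.measurableSet_of_finset`). -/
theorem tightPocket_measurableSet (k n m : ℕ) (A : Finset (Site 3)) :
    MeasurableSet {ω : BondConfig (Site 3) |
        (box 3 n ⊆ A ∧ A ⊆ box 3 m \ innerBoundary (zdGraph 3) (box 3 m)) ∧
          ((edgeBoundary (zdGraph 3) A).filter (· ∈ ω)).card ≤ k + 1 ∧
          ∀ A' : Finset (Site 3), (box 3 n ⊆ A' ∧ A' ⊆ box 3 m \ innerBoundary (zdGraph 3) (box 3 m)) →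
            A' ⊂ A → k + 2 ≤ ((edgeBoundary (zdGraph 3) A').filter (· ∈ ω)).card} := by
  refine DeterminedBy.measurableSet_of_finset (F := edgesTouching (zdGraph 3) A) ?_
  rw [determinedBy_iff]
  intro ω ω' h
  exact tightPocket_local k n m A ω ω' h

end StubTightPocketLocal

/-- **Locality + measurability of the tight-pocket event** (line pocket-resampling-liveness-mass, stub 1). -/
theorem stub_tightPocketLocal :
    (∀ (k n m : ℕ) (A : Finset (Site 3)) (ω ω' : BondConfig (Site 3)),
      ω ∩ (↑(edgesTouching (zdGraph 3) A) : Set (Sym2 (Site 3))) = ω' ∩ ↑(edgesTouching (zdGraph 3) A) →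
      (((box 3 n ⊆ A ∧ A ⊆ box 3 m \ innerBoundary (zdGraph 3) (box 3 m)) ∧
          ((edgeBoundary (zdGraph 3) A).filter (· ∈ ω)).card ≤ k + 1 ∧
          ∀ A' : Finset (Site 3), (box 3 n ⊆ A' ∧ A' ⊆ box 3 m \ innerBoundary (zdGraph 3) (box 3 m)) →
            A' ⊂ A → k + 2 ≤ ((edgeBoundary (zdGraph 3) A').filter (· ∈ ω)).card) ↔
        ((box 3 n ⊆ A ∧ A ⊆ box 3 m \ innerBoundary (zdGraph 3) (box 3 m)) ∧
          ((edgeBoundary (zdGraph 3) A).filter (· ∈ ω')).card ≤ k + 1 ∧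
          ∀ A' : Finset (Site 3), (box 3 n ⊆ A' ∧ A' ⊆ box 3 m \ innerBoundary (zdGraph 3) (box 3 m)) →
            A' ⊂ A → k + 2 ≤ ((edgeBoundary (zdGraph 3) A').filter (· ∈ ω')).card))) ∧
    (∀ (k n m : ℕ) (A : Finset (Site 3)), MeasurableSet {ω : BondConfig (Site 3) |
        (box 3 n ⊆ A ∧ A ⊆ box 3 m \ innerBoundary (zdGraph 3) (box 3 m)) ∧
          ((edgeBoundary (zdGraph 3) A).filter (· ∈ ω)).card ≤ k + 1 ∧
          ∀ A' : Finset (Site 3), (box 3 n ⊆ A' ∧ A' ⊆ box 3 m \ innerBoundary (zdGraph 3) (box 3 m)) →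
            A' ⊂ A → k + 2 ≤ ((edgeBoundary (zdGraph 3) A').filter (· ∈ ω)).card}) :=
  ⟨fun k n m A ω ω' h => StubTightPocketLocal.tightPocket_local k n m A ω ω' h,
    fun k n m A => StubTightPocketLocal.tightPocket_measurableSet k n m A⟩

end Summit.CriticalPhenomena.PercolationContinuityZ3.Theorems
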